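import Summits.BirchSwinnertonDyer.BirchSwinnertonDyer.Theorems.KimAtThreeSemiLocalTraceDualTwistLocalDual
import HarnessLib

/-!
# Route `KimAtThreeKolyvagin` (W2): the lattice-lemma step (d) INSIDE `L_𝔓 = ℚ(ζ_m)_𝔓` —
# `(E_p(φ)⁻¹·𝒪_𝔓)^∨ = E_p(φ⁻¹)·𝒪_𝔓` for the Euler operator `E_p(X) = (p − aX + X²)/p`

Cell `bsd-addord`, seat `bsd-addord-w2-acc3` (PROGRAMME PART 1b row (3), gen 6); tenth file of the
trace-duality set (companion of `KimAtThreeSemiLocalTraceDualTwistLocalDual`);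
`--supports stmt-BirchSwinnertonDyer-19679` (helper).  TOOL theorems only (no definition, no named fact, no
instance, no `sorry`); pure algebra of `ℚ(ζ_m)`; nothing about any curve.

WHY.  Seat w2-c4 gen 9's LATTICE LEMMA (W2C4-ANOMALOUS-PORT-g9 §2): for `K/ℚ_p` unramified with arithmetic
Frobenius `φ`, good reduction, `E(K)[p] = 0`: (a)–(c) `log_ω(E(K) ⊗ ℤ_p) = E_p(φ)⁻¹·𝒪_K`; (d) «by trace
duality (adjoint of `g(φ)` is `g(φ⁻¹)`)» `exp*_ω(H¹(K,T)) = E_p(φ⁻¹)·𝒪_K`.  Step (d) is the statement of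
this file at `K = ℚ(ζ_m)_𝔓` (`p ∤ m`), with `φ := (σ_u)_𝔓` (`u ≡ p`; a Frobenius at `𝔓` and a stabiliser of
`𝔓` by `KimAtThreeSemiLocalTraceDualTwistLocal`) and `φ⁻¹ := (σ_w)_𝔓` (`w·[p] = 1`):

* ★★★ `forall_trace_mul_mem_iff_exists_eq_eulerTwistLoc` — **`((P_u^loc)⁻¹𝒪_𝔓)^∨ = P_w^loc·𝒪_𝔓`**
  (`P_u^loc o = p·o − a·φ o + φ² o`, `P_w^loc z = p·z − a·φ⁻¹z + φ⁻²z`; `a ≠ ±(p+1)`): `Tr_{L_𝔓/ℚ_v}(o·y) ∈ 𝒪_v`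
  for every `o` with `P_u^loc o ∈ 𝒪_𝔓` iff `y = P_w^loc z` for some `z ∈ 𝒪_𝔓` — from the semi-local ★★★
  (`KimAtThreeSemiLocalTraceDualTwistEuler`) on the family `y at 𝔓`.
* `eulerTwistLoc_natCast_mul` (`P^loc(p·x) = p·P^loc x`) and ★★★ `forall_trace_mul_mem_iff_exists_eq_eulerTwistLoc_smul`
  — the `p`-SCALED form, literally **`(E_p(φ)⁻¹𝒪_𝔓)^∨ = E_p(φ⁻¹)𝒪_𝔓`**: `Tr(o·y) ∈ 𝒪_v` for every `o` with
  `P_u^loc o ∈ p·𝒪_𝔓` iff `p·y = P_w^loc z` for some `z ∈ 𝒪_𝔓`.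

So, GIVEN (a)–(c) as `log_ω(E(L_𝔓) ⊗ ℤ_p) = {o : P_u^loc o ∈ p𝒪_𝔓}` and the pairing (S5b)
`Tr(exp*_ω(z)·log_ω(P)) ∈ ℤ_p`, the dual exponential of EVERY class lands in `p⁻¹·P_w^loc·𝒪_𝔓 = E_p(φ⁻¹)𝒪_𝔓`
(«⟹» half; the «⟸» half is the exactness).  HONEST LIMITS: pure algebra; (a)–(c) and (S5b) are NOT here.

References: [Kim2022StructureSelmer] Lemma 3.4, Cor. 3.5, §3.4.1 and the proof of Thm. 3.13;
[BlochKato1990] Prop. 3.8; [Kato2004Asterisque] §9.4; [CasselsFrohlichANT1967] Ch. II §10–§11, Ch. VII §1.1;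
[Washington1997] Thm. 2.13.
-/

set_option autoImplicit false
-- the Theorems namespace of a single-conjunct summit repeats the summit name by design (D-0017)
set_option linter.dupNamespace false
-- `CyclotomicField m ℚ`'s two `ℚ`-algebra structures agree only up to unfolding (as in the sibling files)
set_option backward.isDefEq.respectTransparency false

noncomputable section

open scoped TensorProduct NumberField BigOperators Pointwise
open NumberField IsDedekindDomain
open Literature.NumberTheory.EllipticCurves Literature.NumberTheory.EllipticCurves.Kato2004.EulerSystemValues
open Literature.NumberTheory.Automorphic Literature.NumberTheory.AdelicBaseChange
open Summit.BirchSwinnertonDyer.Rank1Residual.GaloisImage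
open Summit.BirchSwinnertonDyer.BirchSwinnertonDyer.Theorems.KimAtThreePortSharedSATCore
open Summit.BirchSwinnertonDyer.BirchSwinnertonDyer.Theorems.KimAtThreeSemiLocalTraceDualTwist
open Summit.BirchSwinnertonDyer.BirchSwinnertonDyer.Theorems.KimAtThreeSemiLocalTraceDualTwistEuler
open Summit.BirchSwinnertonDyer.BirchSwinnertonDyer.Theorems.KimAtThreeSemiLocalTraceDualTwistLocal
open Summit.BirchSwinnertonDyer.BirchSwinnertonDyer.Theorems.KimAtThreeSemiLocalTraceDualTwistLocalDual

namespace Summit.BirchSwinnertonDyer.BirchSwinnertonDyer.Theorems.KimAtThreeSemiLocalTraceDualTwistLocalLattice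

variable (m : ℕ) [NeZero m] (p : ℕ) [Fact p.Prime]

/-! ### §1 `((P_u^loc)⁻¹𝒪_𝔓)^∨ = P_w^loc·𝒪_𝔓` — the lattice-lemma step (d) inside `L_𝔓` -/

/-- ★★★ **`((P_u^loc)⁻¹𝒪_{𝔓₀})^∨ = P_w^loc·𝒪_{𝔓₀}`** (`p ∤ m`, `u ≡ p`, `w·[p] = 1`, `a ≠ ±(p+1)`): for
`y ∈ L_{𝔓₀}`, `Tr_{L_{𝔓₀}/ℚ_v}(o·y) ∈ 𝒪_v` for every `o` with `p·o − a·φ o + φ² o ∈ 𝒪_{𝔓₀}` iff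
`y = p·z − a·φ⁻¹z + φ⁻²z` for some `z ∈ 𝒪_{𝔓₀}` — seat w2-c4 gen 9's «`log_ω = E_p(φ)⁻¹·𝒪_K` ⟹
`(log_ω)^∨ = E_p(φ⁻¹)·𝒪_K` by trace duality» INSIDE the local field (the `p`-scaling is the next theorem).
From the semi-local ★★★ (`KimAtThreeSemiLocalTraceDualTwistEuler`) on the family `y at 𝔓₀`.
[cite: Kim2022StructureSelmer, Lemma 3.4, Cor. 3.5 and the proof of Thm. 3.13 (arXiv v3 pp. 17–18, 26–28)] -/
theorem forall_trace_mul_mem_iff_exists_eq_eulerTwistLoc (hpm : ¬ p ∣ m)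
    [Fintype (((Rat.HeightOneSpectrum.primesEquiv (R := 𝓞 ℚ)).symm ⟨p, Fact.out⟩).Extension
      (𝓞 (CyclotomicField m ℚ)))]
    (u w : (ZMod m)ˣ) (hu : (u : ZMod m) = (p : ZMod m)) (hw : (w : ZMod m) * ((p : ℕ) : ZMod m) = 1)
    {a : ℤ} (ha : a ≠ (p : ℤ) + 1) (ha' : a ≠ -((p : ℤ) + 1))
    (𝔓₀ : ((Rat.HeightOneSpectrum.primesEquiv (R := 𝓞 ℚ)).symm ⟨p, Fact.out⟩).Extension
      (𝓞 (CyclotomicField m ℚ)))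
    (y : 𝔓₀.1.adicCompletion (CyclotomicField m ℚ)) :
    (∀ o : 𝔓₀.1.adicCompletion (CyclotomicField m ℚ),
      (p : 𝔓₀.1.adicCompletion (CyclotomicField m ℚ)) * o -
          (a : 𝔓₀.1.adicCompletion (CyclotomicField m ℚ)) *
            galAdicCompletionMap (sigma m u) (sigma_smul_eq_self_of_coe_eq m p hpm u hu 𝔓₀) o +
          galAdicCompletionMap (sigma m u) (sigma_smul_eq_self_of_coe_eq m p hpm u hu 𝔓₀)
            (galAdicCompletionMap (sigma m u) (sigma_smul_eq_self_of_coe_eq m p hpm u hu 𝔓₀) o) ∈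
        𝔓₀.1.adicCompletionIntegers (CyclotomicField m ℚ) →
      Algebra.trace (((Rat.HeightOneSpectrum.primesEquiv (R := 𝓞 ℚ)).symm ⟨p, Fact.out⟩).adicCompletion ℚ)
          (𝔓₀.1.adicCompletion (CyclotomicField m ℚ)) (o * y) ∈
        (((Rat.HeightOneSpectrum.primesEquiv (R := 𝓞 ℚ)).symm ⟨p, Fact.out⟩).adicCompletionIntegers ℚ)) ↔
    ∃ z ∈ 𝔓₀.1.adicCompletionIntegers (CyclotomicField m ℚ),
      y = (p : 𝔓₀.1.adicCompletion (CyclotomicField m ℚ)) * z -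
        (a : 𝔓₀.1.adicCompletion (CyclotomicField m ℚ)) *
          galAdicCompletionMap (sigma m w) (sigma_smul_eq_self_of_mul_coe_eq_one m p hpm w hw 𝔓₀) z +
        galAdicCompletionMap (sigma m w) (sigma_smul_eq_self_of_mul_coe_eq_one m p hpm w hw 𝔓₀)
          (galAdicCompletionMap (sigma m w) (sigma_smul_eq_self_of_mul_coe_eq_one m p hpm w hw 𝔓₀) z) := by
  classical
  obtain ⟨Ψ, hΨ⟩ := exists_padicTensorAlgEquiv (CyclotomicField m ℚ) p
  -- `u⁻¹ = w`
  have hwu : u⁻¹ = w := by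
    refine inv_eq_of_mul_eq_one_left (Units.ext ?_)
    rw [Units.val_mul, hu, Units.val_one]; exact hw
  have hstu : ∀ 𝔓 : ((Rat.HeightOneSpectrum.primesEquiv (R := 𝓞 ℚ)).symm ⟨p, Fact.out⟩).Extension
      (𝓞 (CyclotomicField m ℚ)), sigma m u • 𝔓.1 = 𝔓.1 :=
    fun 𝔓 => sigma_smul_eq_self_of_coe_eq m p hpm u hu 𝔓
  have hstw : ∀ 𝔓 : ((Rat.HeightOneSpectrum.primesEquiv (R := 𝓞 ℚ)).symm ⟨p, Fact.out⟩).Extension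
      (𝓞 (CyclotomicField m ℚ)), sigma m w • 𝔓.1 = 𝔓.1 :=
    fun 𝔓 => sigma_smul_eq_self_of_mul_coe_eq_one m p hpm w hw 𝔓
  -- the family `Y = (y at 𝔓₀, 0 elsewhere)`
  set Y : ℚ_[p] ⊗[ℚ] CyclotomicField m ℚ := Ψ.symm (Pi.single (M := fun 𝔓 :
      ((Rat.HeightOneSpectrum.primesEquiv (R := 𝓞 ℚ)).symm ⟨p, Fact.out⟩).Extension
        (𝓞 (CyclotomicField m ℚ)) => 𝔓.1.adicCompletion (CyclotomicField m ℚ)) 𝔓₀ y) with hYdef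
  have hY : ∀ 𝔓, Ψ Y 𝔓 = Pi.single (M := fun 𝔓 :
      ((Rat.HeightOneSpectrum.primesEquiv (R := 𝓞 ℚ)).symm ⟨p, Fact.out⟩).Extension
        (𝓞 (CyclotomicField m ℚ)) => 𝔓.1.adicCompletion (CyclotomicField m ℚ)) 𝔓₀ y 𝔓 := by
    intro 𝔓; rw [hYdef, AlgEquiv.apply_symm_apply]
  -- the two twists read at every place
  have hPu : ∀ 𝔓 (x : ℚ_[p] ⊗[ℚ] CyclotomicField m ℚ),
      Ψ (∑ g : (ZMod m)ˣ, (((((p : ℕ) : MonoidAlgebra ℤ_[p] (ZMod m)ˣ) -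
        MonoidAlgebra.single u (a : ℤ_[p]) + MonoidAlgebra.single (u ^ 2) (1 : ℤ_[p])).coeff g :
          ℤ_[p]) : ℚ_[p]) • Algebra.TensorProduct.map (AlgHom.id ℚ ℚ_[p])
            (sigma m g : CyclotomicField m ℚ →ₐ[ℚ] CyclotomicField m ℚ) x) 𝔓 =
      (p : 𝔓.1.adicCompletion (CyclotomicField m ℚ)) * Ψ x 𝔓 -
        (a : 𝔓.1.adicCompletion (CyclotomicField m ℚ)) * galAdicCompletionMap (sigma m u) (hstu 𝔓) (Ψ x 𝔓) +
        galAdicCompletionMap (sigma m u) (hstu 𝔓) (galAdicCompletionMap (sigma m u) (hstu 𝔓) (Ψ x 𝔓)) :=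
    fun 𝔓 x => padicTensor_eulerTwist_apply m p (Ψ : ℚ_[p] ⊗[ℚ] CyclotomicField m ℚ →ₐ[ℚ] _) hΨ u a 𝔓
      (hstu 𝔓) x
  have hPw : ∀ 𝔓 (x : ℚ_[p] ⊗[ℚ] CyclotomicField m ℚ),
      Ψ (∑ g : (ZMod m)ˣ, (((((p : ℕ) : MonoidAlgebra ℤ_[p] (ZMod m)ˣ) -
        MonoidAlgebra.single w (a : ℤ_[p]) + MonoidAlgebra.single (w ^ 2) (1 : ℤ_[p])).coeff g :
          ℤ_[p]) : ℚ_[p]) • Algebra.TensorProduct.map (AlgHom.id ℚ ℚ_[p])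
            (sigma m g : CyclotomicField m ℚ →ₐ[ℚ] CyclotomicField m ℚ) x) 𝔓 =
      (p : 𝔓.1.adicCompletion (CyclotomicField m ℚ)) * Ψ x 𝔓 -
        (a : 𝔓.1.adicCompletion (CyclotomicField m ℚ)) * galAdicCompletionMap (sigma m w) (hstw 𝔓) (Ψ x 𝔓) +
        galAdicCompletionMap (sigma m w) (hstw 𝔓) (galAdicCompletionMap (sigma m w) (hstw 𝔓) (Ψ x 𝔓)) :=
    fun 𝔓 x => padicTensor_eulerTwist_apply m p (Ψ : ℚ_[p] ⊗[ℚ] CyclotomicField m ℚ →ₐ[ℚ] _) hΨ w a 𝔓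
      (hstw 𝔓) x
  -- (1) local LHS ↔ semi-local LHS for `Y`
  have hL : (∀ o : 𝔓₀.1.adicCompletion (CyclotomicField m ℚ),
      (p : 𝔓₀.1.adicCompletion (CyclotomicField m ℚ)) * o -
          (a : 𝔓₀.1.adicCompletion (CyclotomicField m ℚ)) *
            galAdicCompletionMap (sigma m u) (hstu 𝔓₀) o +
          galAdicCompletionMap (sigma m u) (hstu 𝔓₀) (galAdicCompletionMap (sigma m u) (hstu 𝔓₀) o) ∈
        𝔓₀.1.adicCompletionIntegers (CyclotomicField m ℚ) →
      Algebra.trace (((Rat.HeightOneSpectrum.primesEquiv (R := 𝓞 ℚ)).symm ⟨p, Fact.out⟩).adicCompletion ℚ)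
          (𝔓₀.1.adicCompletion (CyclotomicField m ℚ)) (o * y) ∈
        (((Rat.HeightOneSpectrum.primesEquiv (R := 𝓞 ℚ)).symm ⟨p, Fact.out⟩).adicCompletionIntegers ℚ)) ↔
      ∀ x : ℚ_[p] ⊗[ℚ] CyclotomicField m ℚ,
        ∑ g : (ZMod m)ˣ, (((((p : ℕ) : MonoidAlgebra ℤ_[p] (ZMod m)ˣ) -
          MonoidAlgebra.single u (a : ℤ_[p]) + MonoidAlgebra.single (u ^ 2) (1 : ℤ_[p])).coeff g :
            ℤ_[p]) : ℚ_[p]) • Algebra.TensorProduct.map (AlgHom.id ℚ ℚ_[p])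
              (sigma m g : CyclotomicField m ℚ →ₐ[ℚ] CyclotomicField m ℚ) x ∈ cycIntLattice p m →
        ‖Algebra.trace ℚ_[p] (ℚ_[p] ⊗[ℚ] CyclotomicField m ℚ) (x * Y)‖ ≤ 1 := by
    constructor
    · intro hloc x hx
      rw [norm_le_one_iff_adicCompletionEquiv_mem, hYdef, trace_mul_symm_single m p Ψ hΨ 𝔓₀ y]
      apply hloc
      rw [← hPu 𝔓₀ x]
      exact (mem_cycIntLattice_iff_forall_padicTensor_mem m p hpm Ψ hΨ _).mp hx 𝔓₀
    · intro hsem o hPo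
      have hx : ∑ g : (ZMod m)ˣ, (((((p : ℕ) : MonoidAlgebra ℤ_[p] (ZMod m)ˣ) -
          MonoidAlgebra.single u (a : ℤ_[p]) + MonoidAlgebra.single (u ^ 2) (1 : ℤ_[p])).coeff g :
            ℤ_[p]) : ℚ_[p]) • Algebra.TensorProduct.map (AlgHom.id ℚ ℚ_[p])
              (sigma m g : CyclotomicField m ℚ →ₐ[ℚ] CyclotomicField m ℚ)
              (Ψ.symm (Pi.single (M := fun 𝔓 : ((Rat.HeightOneSpectrum.primesEquiv (R := 𝓞 ℚ)).symm
                ⟨p, Fact.out⟩).Extension (𝓞 (CyclotomicField m ℚ)) => 𝔓.1.adicCompletion (CyclotomicField m ℚ))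
                𝔓₀ o)) ∈ cycIntLattice p m := by
        rw [eulerTwist_mem_cycIntLattice_iff_forall_of_smul_eq m p hpm Ψ hΨ u hstu a]
        intro 𝔓
        rw [AlgEquiv.apply_symm_apply]
        by_cases h𝔓 : 𝔓 = 𝔓₀
        · subst h𝔓; rw [Pi.single_eq_same]; exact hPo
        · rw [Pi.single_eq_of_ne h𝔓, eulerTwistLoc_zero]; exact zero_mem _
      have h := hsem _ hx
      rw [norm_le_one_iff_adicCompletionEquiv_mem, hYdef, trace_mul_symm_single m p Ψ hΨ 𝔓₀ y,
        AlgEquiv.apply_symm_apply, Pi.single_eq_same] at h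
      exact h
  -- (2) the semi-local ★★★ for `Y` (twist `P_u`, adjoint `P_{u⁻¹} = P_w`)
  have hsemi := forall_norm_trace_mul_le_one_iff_exists_eq_eulerTwist_inv m p hpm u ha ha' Y
  rw [hwu] at hsemi
  -- (3) semi-local RHS ↔ local RHS
  have hR : (∃ z ∈ cycIntLattice p m, Y = ∑ g : (ZMod m)ˣ, (((((p : ℕ) : MonoidAlgebra ℤ_[p] (ZMod m)ˣ) -
        MonoidAlgebra.single w (a : ℤ_[p]) + MonoidAlgebra.single (w ^ 2) (1 : ℤ_[p])).coeff g :
          ℤ_[p]) : ℚ_[p]) • Algebra.TensorProduct.map (AlgHom.id ℚ ℚ_[p])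
            (sigma m g : CyclotomicField m ℚ →ₐ[ℚ] CyclotomicField m ℚ) z) ↔
      ∃ z ∈ 𝔓₀.1.adicCompletionIntegers (CyclotomicField m ℚ),
        y = (p : 𝔓₀.1.adicCompletion (CyclotomicField m ℚ)) * z -
          (a : 𝔓₀.1.adicCompletion (CyclotomicField m ℚ)) *
            galAdicCompletionMap (sigma m w) (hstw 𝔓₀) z +
          galAdicCompletionMap (sigma m w) (hstw 𝔓₀) (galAdicCompletionMap (sigma m w) (hstw 𝔓₀) z) := by
    constructor
    · rintro ⟨z, hz, hYz⟩
      refine ⟨Ψ z 𝔓₀, (mem_cycIntLattice_iff_forall_padicTensor_mem m p hpm Ψ hΨ z).mp hz 𝔓₀, ?_⟩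
      have h0 := hY 𝔓₀
      rw [Pi.single_eq_same, hYz, hPw] at h0
      exact h0.symm
    · rintro ⟨z₀, hz₀, hy⟩
      refine ⟨Ψ.symm (Pi.single (M := fun 𝔓 : ((Rat.HeightOneSpectrum.primesEquiv (R := 𝓞 ℚ)).symm
          ⟨p, Fact.out⟩).Extension (𝓞 (CyclotomicField m ℚ)) => 𝔓.1.adicCompletion (CyclotomicField m ℚ)) 𝔓₀ z₀),
        symm_single_mem_cycIntLattice m p hpm Ψ hΨ 𝔓₀ hz₀, Ψ.injective (funext fun 𝔓 => ?_)⟩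
      rw [hY, hPw, AlgEquiv.apply_symm_apply]
      by_cases h𝔓 : 𝔓 = 𝔓₀
      · subst h𝔓; rw [Pi.single_eq_same, Pi.single_eq_same]; exact hy
      · rw [Pi.single_eq_of_ne h𝔓, Pi.single_eq_of_ne h𝔓, eulerTwistLoc_zero]
  exact hL.trans (hsemi.trans hR)

/-! ### §2 The `p`-scaled form: `(E_p(φ)⁻¹𝒪_𝔓)^∨ = E_p(φ⁻¹)𝒪_𝔓` -/

omit [NeZero m] [Fact p.Prime] in
/-- The local Euler operator commutes with multiplication by `p`: `P^loc(p·x) = p·P^loc x` (`S` is a ring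
map, `S p = p`). [folklore] -/
theorem eulerTwistLoc_natCast_mul {R : Type*} [CommRing R] (S : R →+* R) (a : ℤ) (x : R) :
    (p : R) * ((p : R) * x) - (a : R) * S ((p : R) * x) + S (S ((p : R) * x)) =
      (p : R) * ((p : R) * x - (a : R) * S x + S (S x)) := by
  simp only [map_mul, map_natCast]
  ring

/-- ★★★ **`(E_p(φ)⁻¹𝒪_𝔓)^∨ = E_p(φ⁻¹)𝒪_𝔓`, literally** (`p ∤ m`, `u ≡ p`, `w·[p] = 1`, `a ≠ ±(p+1)`): for
`y ∈ L_{𝔓₀}`, `Tr_{L_{𝔓₀}/ℚ_v}(o·y) ∈ 𝒪_v` for every `o` with `p·o − a·φ o + φ² o ∈ p·𝒪_{𝔓₀}` (i.e.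
`o ∈ E_p(φ)⁻¹𝒪_{𝔓₀}`) iff `p·y = p·z − a·φ⁻¹z + φ⁻²z` for some `z ∈ 𝒪_{𝔓₀}` (i.e. `y ∈ E_p(φ⁻¹)𝒪_{𝔓₀}`).
§1 applied to `p·y` (`E_p(φ)⁻¹𝒪 = p·(P_u^loc)⁻¹𝒪` since `P^loc` commutes with `p`).
[cite: Kim2022StructureSelmer, Lemma 3.4, Cor. 3.5 and the proof of Thm. 3.13 (arXiv v3 pp. 17–18, 26–28)] -/
theorem forall_trace_mul_mem_iff_exists_eq_eulerTwistLoc_smul (hpm : ¬ p ∣ m)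
    [Fintype (((Rat.HeightOneSpectrum.primesEquiv (R := 𝓞 ℚ)).symm ⟨p, Fact.out⟩).Extension
      (𝓞 (CyclotomicField m ℚ)))]
    (u w : (ZMod m)ˣ) (hu : (u : ZMod m) = (p : ZMod m)) (hw : (w : ZMod m) * ((p : ℕ) : ZMod m) = 1)
    {a : ℤ} (ha : a ≠ (p : ℤ) + 1) (ha' : a ≠ -((p : ℤ) + 1))
    (𝔓₀ : ((Rat.HeightOneSpectrum.primesEquiv (R := 𝓞 ℚ)).symm ⟨p, Fact.out⟩).Extension
      (𝓞 (CyclotomicField m ℚ)))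
    (y : 𝔓₀.1.adicCompletion (CyclotomicField m ℚ)) :
    (∀ o : 𝔓₀.1.adicCompletion (CyclotomicField m ℚ),
      (∃ o' ∈ 𝔓₀.1.adicCompletionIntegers (CyclotomicField m ℚ),
        (p : 𝔓₀.1.adicCompletion (CyclotomicField m ℚ)) * o -
          (a : 𝔓₀.1.adicCompletion (CyclotomicField m ℚ)) *
            galAdicCompletionMap (sigma m u) (sigma_smul_eq_self_of_coe_eq m p hpm u hu 𝔓₀) o +
          galAdicCompletionMap (sigma m u) (sigma_smul_eq_self_of_coe_eq m p hpm u hu 𝔓₀)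
            (galAdicCompletionMap (sigma m u) (sigma_smul_eq_self_of_coe_eq m p hpm u hu 𝔓₀) o) =
          (p : 𝔓₀.1.adicCompletion (CyclotomicField m ℚ)) * o') →
      Algebra.trace (((Rat.HeightOneSpectrum.primesEquiv (R := 𝓞 ℚ)).symm ⟨p, Fact.out⟩).adicCompletion ℚ)
          (𝔓₀.1.adicCompletion (CyclotomicField m ℚ)) (o * y) ∈
        (((Rat.HeightOneSpectrum.primesEquiv (R := 𝓞 ℚ)).symm ⟨p, Fact.out⟩).adicCompletionIntegers ℚ)) ↔
    ∃ z ∈ 𝔓₀.1.adicCompletionIntegers (CyclotomicField m ℚ),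
      (p : 𝔓₀.1.adicCompletion (CyclotomicField m ℚ)) * y =
        (p : 𝔓₀.1.adicCompletion (CyclotomicField m ℚ)) * z -
        (a : 𝔓₀.1.adicCompletion (CyclotomicField m ℚ)) *
          galAdicCompletionMap (sigma m w) (sigma_smul_eq_self_of_mul_coe_eq_one m p hpm w hw 𝔓₀) z +
        galAdicCompletionMap (sigma m w) (sigma_smul_eq_self_of_mul_coe_eq_one m p hpm w hw 𝔓₀)
          (galAdicCompletionMap (sigma m w) (sigma_smul_eq_self_of_mul_coe_eq_one m p hpm w hw 𝔓₀) z) := by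
  rw [← forall_trace_mul_mem_iff_exists_eq_eulerTwistLoc m p hpm u w hu hw ha ha' 𝔓₀
    ((p : 𝔓₀.1.adicCompletion (CyclotomicField m ℚ)) * y)]
  have hp0 : (p : 𝔓₀.1.adicCompletion (CyclotomicField m ℚ)) ≠ 0 := by
    rw [← map_natCast (algebraMap (CyclotomicField m ℚ) (𝔓₀.1.adicCompletion (CyclotomicField m ℚ)))]
    exact (map_ne_zero_iff _ (algebraMap (CyclotomicField m ℚ) _).injective).mpr
      (Nat.cast_ne_zero.mpr (Fact.out : p.Prime).ne_zero)
  constructor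
  · -- given `o` with `P_u o ∈ 𝒪`: `P_u (p·o) = p·P_u o ∈ p𝒪`, and `Tr(o·(p y)) = Tr((p o)·y)`
    intro h o hPo
    have h' := h ((p : 𝔓₀.1.adicCompletion (CyclotomicField m ℚ)) * o) ⟨_, hPo, by
      rw [eulerTwistLoc_natCast_mul]⟩
    rw [mul_left_comm]
    rwa [mul_assoc] at h'
  · -- given `o` with `P_u o = p·o'`, `o' ∈ 𝒪`: `q := o/p` has `P_u q = o'`, and `Tr(q·(p y)) = Tr(o·y)`
    intro h o ⟨o', ho', hPo⟩
    have hq : (p : 𝔓₀.1.adicCompletion (CyclotomicField m ℚ)) *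
        ((p : 𝔓₀.1.adicCompletion (CyclotomicField m ℚ))⁻¹ * o) = o := mul_inv_cancel_left₀ hp0 o
    have h' := h ((p : 𝔓₀.1.adicCompletion (CyclotomicField m ℚ))⁻¹ * o) (by
      have e := eulerTwistLoc_natCast_mul p
        (galAdicCompletionMap (sigma m u) (sigma_smul_eq_self_of_coe_eq m p hpm u hu 𝔓₀)) a
        ((p : 𝔓₀.1.adicCompletion (CyclotomicField m ℚ))⁻¹ * o)
      rw [hq, hPo] at e
      rw [hq, ← mul_left_cancel₀ hp0 e]
      exact ho')
    rwa [mul_left_comm, ← mul_assoc, hq] at h'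


end Summit.BirchSwinnertonDyer.BirchSwinnertonDyer.Theorems.KimAtThreeSemiLocalTraceDualTwistLocalLattice

end
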